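import Literature.AlgebraicTopology.SingularHomology.StdSimplexFaces
import Literature.AlgebraicTopology.SingularHomology.ChainSubcomplex
import Mathlib.Analysis.Convex.Contractible
import HarnessLib

/-!
# Universal prism chains on the cylinders `Δⁿ × I`

Topic `Literature/AlgebraicTopology/SingularHomology`. The chain-level content of the homotopy
invariance of singular homology (A. Hatcher, *Algebraic Topology*, CUP 2002, Thm. 2.10 and its
proof, the prism operator `P` with `∂P + P∂ = g♯ - f♯`) in the *universal* form of
S. Eilenberg, Singular homology theory, Ann. of Math. 45 (1944), §§4–5 / the method of acyclic
models: instead of Hatcher's explicit prism simplices `[v₀, …, vᵢ, wᵢ, …, wₙ]` we construct, by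
induction on `n` and using only that the cylinder `Δⁿ × I` is contractible (hence acyclic), chains

`prismChain R n ∈ Cₙ₊₁(Δⁿ × I; R)`

on the cylinders `Literature.AlgebraicTopology.SingularHomology.Cyl n = Δⁿ × I` (lifted to an
arbitrary universe so that they can be pushed forward to any space), with the **prism boundary
formula** (`bd_prismChain_succ`, `bd_prismChain_zero`)

`∂ (prismChain (n+1)) = ι₁ - ι₀ - ∑ⱼ (-1)ʲ (δⱼ × 1)♯ (prismChain n)`,  `∂ (prismChain 0) = ι₁ - ι₀`,

where `ι₁`, `ι₀` are the top and bottom inclusions `Δⁿ → Δⁿ × I` as singular simplices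
(`topSimplex`, `botSimplex`) and `δⱼ × 1 = cylFace n j : Δⁿ × I → Δⁿ⁺¹ × I` are the faces of the
cylinder. Pushing `prismChain n` forward along a homotopy `Δⁿ × I → X` of a single singular simplex
gives the prism chain of that homotopy (used in `HurewiczCompression.lean` for the vanishing
clause of the Hurewicz theorem). The inductive step needs the cycle
`ι₁ - ι₀ - ∑ⱼ (-1)ʲ (δⱼ × 1)♯ (prismChain n)` to be a boundary: it is a cycle by the formula one
degree down and `∑ⱼ ∑ᵢ (-1)ⁱ⁺ʲ (δⱼ × 1)♯ (δᵢ × 1)♯ = 0`, which we obtain from Mathlib's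
`AlternatingCofaceMapComplex.d_squared` applied to the cosimplicial module
`n ↦ Cₖ(Δⁿ × I; R)` (`cylChains`), and the cylinder is acyclic
(`isZero_csingularHomology_of_contractibleSpace`).

Everything is in the concrete model `Literature.AlgebraicTopology.SingularHomology.csingularChainComplex`
(chains `CChain R W n = (SingularSimplex W n →₀ R)`), with ring coefficients `M = R`.
All declarations are definitions with bodies and proved lemmas; nothing is asserted.

## Main definitions and results

* `Cyl n`, `cylMap`, `cylFace`, `cylIncl`, `topSimplex`, `botSimplex`, `cylChains`;
* `prismChain R n` with `bd_prismChain_zero`, `bd_prismChain_succ`.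

## References

* A. Hatcher, *Algebraic Topology*, CUP 2002, §2.1, Thm. 2.10 (prism operator). [HatcherAT2002]
* S. Eilenberg, Singular homology theory, Ann. of Math. (2) 45 (1944), 407–447 (prisms built by
  acyclicity). [folklore attribution; statements below are tagged folklore]
-/

noncomputable section

open CategoryTheory Limits AlgebraicTopology

universe u v

namespace Literature.AlgebraicTopology.SingularHomology

variable {X Y : Type u} [TopologicalSpace X] [TopologicalSpace Y]

open SingularSimplex

/-! ### The cylinders `Δⁿ × I` -/

/-- The cylinder `Δⁿ × I` over the standard `n`-simplex, lifted to universe `u` (so that its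
singular chains can be pushed forward to spaces in `Type u`). [folklore] -/
abbrev Cyl (n : ℕ) : Type u := ULift.{u} (StdSimplex n × unitInterval)

/-- The cylinder is contractible (it is convex). [folklore] -/
instance Cyl.contractibleSpace (n : ℕ) : ContractibleSpace (Cyl.{u} n) := by
  haveI : ContractibleSpace (StdSimplex n) :=
    (convex_stdSimplex ℝ (Fin (n + 1))).contractibleSpace ⟨_, (stdSimplex.vertex (S := ℝ) 0).2⟩
  haveI : ContractibleSpace unitInterval := (convex_Icc (0 : ℝ) 1).contractibleSpace ⟨0, by simp⟩
  exact Homeomorph.ulift.contractibleSpace_iff.mpr inferInstance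

/-- The map of cylinders `Δᵐ × I → Δⁿ × I` induced by a morphism `θ : ⦋m⦌ ⟶ ⦋n⦌` of the simplex
category (Mathlib's `stdSimplex.map θ` on the first factor). [folklore] -/
def cylMap {m n : SimplexCategory} (θ : m ⟶ n) : C(Cyl.{u} m.len, Cyl.{u} n.len) where
  toFun p := ⟨(stdSimplex.map θ.toOrderHom p.down.1, p.down.2)⟩
  continuous_toFun :=
    continuous_uliftUp.comp (((stdSimplex.continuous_map _).comp
      (continuous_fst.comp continuous_uliftDown)).prodMk (continuous_snd.comp continuous_uliftDown))

/-- `cylMap` of an identity is the identity. [folklore] -/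
lemma cylMap_id (n : SimplexCategory) : cylMap (𝟙 n) = ContinuousMap.id (Cyl.{u} n.len) := by
  ext p : 1
  rcases p with ⟨z, t⟩
  change ULift.up (stdSimplex.map (id : Fin (n.len + 1) → Fin (n.len + 1)) z, t) = _
  rw [stdSimplex.map_id_apply]
  rfl

/-- `cylMap` is functorial. [folklore] -/
lemma cylMap_comp {l m n : SimplexCategory} (θ : l ⟶ m) (θ' : m ⟶ n) :
    cylMap (θ ≫ θ') = (cylMap.{u} θ').comp (cylMap θ) := by
  ext p : 1
  rcases p with ⟨z, t⟩
  change ULift.up (stdSimplex.map (θ'.toOrderHom ∘ θ.toOrderHom) z, t) =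
    ULift.up (stdSimplex.map θ'.toOrderHom (stdSimplex.map θ.toOrderHom z), t)
  rw [stdSimplex.map_comp_apply]

/-- The `j`-th face `δⱼ × 1 : Δⁿ × I → Δⁿ⁺¹ × I` of the cylinder. [folklore] -/
def cylFace (n : ℕ) (j : Fin (n + 2)) : C(Cyl.{u} n, Cyl.{u} (n + 1)) :=
  cylMap (SimplexCategory.δ j)

/-- Pointwise formula: `(δⱼ × 1)(z, t) = (δⱼ z, t)`. [folklore] -/
@[simp]
lemma cylFace_apply (n : ℕ) (j : Fin (n + 2)) (z : StdSimplex n) (t : unitInterval) :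
    cylFace.{u} n j ⟨(z, t)⟩ = ⟨(stdFace j z, t)⟩ := rfl

/-- The inclusion `ιₜ : Δⁿ → Δⁿ × I`, `z ↦ (z, t)`, at height `t`. [folklore] -/
def cylIncl (n : ℕ) (t : unitInterval) : C(StdSimplex n, Cyl.{u} n) where
  toFun z := ⟨(z, t)⟩
  continuous_toFun := continuous_uliftUp.comp (continuous_id.prodMk continuous_const)

/-- Pointwise formula for `cylIncl`. [folklore] -/
@[simp]
lemma cylIncl_apply (n : ℕ) (t : unitInterval) (z : StdSimplex n) : cylIncl.{u} n t z = ⟨(z, t)⟩ := rfl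

/-- The top `ι₁ : Δⁿ → Δⁿ × I` as a singular `n`-simplex of the cylinder. [folklore] -/
def topSimplex (n : ℕ) : SingularSimplex (Cyl.{u} n) n := ofMap (cylIncl n 1)

/-- The bottom `ι₀ : Δⁿ → Δⁿ × I` as a singular `n`-simplex of the cylinder. [folklore] -/
def botSimplex (n : ℕ) : SingularSimplex (Cyl.{u} n) n := ofMap (cylIncl n 0)

/-- The faces of the top simplex of `Δⁿ⁺¹ × I` are the top simplices of the faces `Δⁿ × I`,
pushed into `Δⁿ⁺¹ × I`. [folklore] -/
lemma topSimplex_face (n : ℕ) (j : Fin (n + 2)) :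
    (topSimplex.{u} (n + 1)).face j = (topSimplex n).map (cylFace n j) := by
  rw [topSimplex, topSimplex, ofMap_face, ofMap_map]
  rfl

/-- The faces of the bottom simplex of `Δⁿ⁺¹ × I` are the bottom simplices of the faces. [folklore] -/
lemma botSimplex_face (n : ℕ) (j : Fin (n + 2)) :
    (botSimplex.{u} (n + 1)).face j = (botSimplex n).map (cylFace n j) := by
  rw [botSimplex, botSimplex, ofMap_face, ofMap_map]
  rfl

/-! ### Chains on the cylinders -/

variable (R : Type v) [CommRing R]

/-- Push-forward of concrete chains along a continuous map, degree `k` (the component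
`(csingularChainComplex.map R R f).f k`, i.e. `Finsupp.mapDomain (· .map f)`). [folklore] -/
abbrev chainPush {W W' : Type u} [TopologicalSpace W] [TopologicalSpace W'] (f : C(W, W')) (k : ℕ) :
    CChain R W k →ₗ[R] CChain R W' k :=
  Finsupp.lmapDomain R R fun τ : SingularSimplex W k => τ.map f

variable {R}

/-- `chainPush f` on an elementary chain. [folklore] -/
@[simp]
lemma chainPush_single {W W' : Type u} [TopologicalSpace W] [TopologicalSpace W'] (f : C(W, W'))
    {k : ℕ} (τ : SingularSimplex W k) (r : R) :
    chainPush R f k (Finsupp.single τ r) = Finsupp.single (τ.map f) r :=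
  Finsupp.mapDomain_single

/-- `chainPush f` is the degree-`k` component of the chain map `f♯`. [folklore] -/
lemma chainPush_eq_map_f {W W' : Type u} [TopologicalSpace W] [TopologicalSpace W'] (f : C(W, W'))
    (k : ℕ) (c : CChain R W k) : chainPush R f k c = (csingularChainComplex.map R R f).f k c := rfl

/-- Push-forward commutes with the boundary: `∂ f♯ = f♯ ∂` (Hatcher 2002, §2.1). [folklore] -/
lemma bd_chainPush {W W' : Type u} [TopologicalSpace W] [TopologicalSpace W'] (f : C(W, W'))
    (k : ℕ) (c : CChain R W (k + 1)) :
    csingularChainComplex.bd R k (chainPush R f (k + 1) c) = chainPush R f k (csingularChainComplex.bd R k c) := by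
  rw [← LinearMap.comp_apply, ← LinearMap.comp_apply]
  congr 1
  refine Finsupp.lhom_ext fun τ r => ?_
  rw [LinearMap.comp_apply, LinearMap.comp_apply, chainPush_single, csingularChainComplex.bd_single,
    csingularChainComplex.bd_single, map_sum]
  refine Finset.sum_congr rfl fun i _ => ?_
  rw [map_smul, chainPush_single, SingularSimplex.face_map]

/-- Push-forward is functorial: `(g ∘ f)♯ = g♯ ∘ f♯`. [folklore] -/
lemma chainPush_comp {W W' W'' : Type u} [TopologicalSpace W] [TopologicalSpace W'] [TopologicalSpace W'']
    (f : C(W, W')) (g : C(W', W'')) (k : ℕ) (c : CChain R W k) :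
    chainPush R (g.comp f) k c = chainPush R g k (chainPush R f k c) := by
  change Finsupp.mapDomain _ c = Finsupp.mapDomain _ (Finsupp.mapDomain _ c)
  rw [← Finsupp.mapDomain_comp]
  congr 1

/-- The cosimplicial `R`-module `⦋n⦌ ↦ Cₖ(Δⁿ × I; R)` of singular `k`-CHAINS on the cylinders
(cosimplicial in the simplex index `n` only: the cofaces are the push-forwards along `cylMap`;
nothing to do with cochains). Its alternating coface differential is `∑ⱼ (-1)ʲ (δⱼ × 1)♯`, whose
square vanishes (Mathlib, `AlternatingCofaceMapComplex.d_squared`). [folklore] -/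
def cylChains (R : Type v) [CommRing R] (k : ℕ) : CosimplicialObject (ModuleCat.{max u v} R) where
  obj n := ModuleCat.of R (CChain R (Cyl.{u} n.len) k)
  map θ := ModuleCat.ofHom (chainPush R (cylMap θ) k)
  map_id n := by
    apply ModuleCat.hom_ext
    refine Finsupp.lhom_ext fun τ r => ?_
    rw [ModuleCat.hom_ofHom, chainPush_single, cylMap_id, SingularSimplex.map_id]
    rfl
  map_comp θ θ' := by
    apply ModuleCat.hom_ext
    refine Finsupp.lhom_ext fun τ r => ?_
    rw [ModuleCat.hom_ofHom, ModuleCat.hom_comp, LinearMap.comp_apply, ModuleCat.hom_ofHom,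
      ModuleCat.hom_ofHom, chainPush_single, chainPush_single, chainPush_single, cylMap_comp, SingularSimplex.map_comp]

variable (R) in
/-- The prism rim operator `c ↦ ∑ⱼ (-1)ʲ (δⱼ × 1)♯ c : Cₖ(Δⁿ × I) → Cₖ(Δⁿ⁺¹ × I)` (the terms
`P ∂` of Hatcher's `∂P + P∂`, Hatcher 2002, proof of Thm. 2.10). [folklore] -/
def prismRim (n k : ℕ) (c : CChain R (Cyl.{u} n) k) : CChain R (Cyl.{u} (n + 1)) k :=
  ∑ j : Fin (n + 2), ((-1 : R) ^ (j : ℕ)) • chainPush R (cylFace n j) k c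

/-- The rim operator is the alternating coface differential of `cylChains`. [folklore] -/
lemma cylChains_objD_hom_apply (n k : ℕ) (c : CChain R (Cyl.{u} n) k) :
    (AlternatingCofaceMapComplex.objD (cylChains.{u} R k) n).hom c = prismRim R n k c := by
  simp only [AlternatingCofaceMapComplex.objD]
  rw [ModuleCat.hom_sum, LinearMap.coe_sum, Finset.sum_apply]
  refine Finset.sum_congr rfl fun j _ => ?_
  rw [ModuleCat.hom_zsmul, LinearMap.smul_apply, ← Int.cast_smul_eq_zsmul R, Int.cast_pow,
    Int.cast_neg, Int.cast_one]
  rfl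

/-- `∑ⱼ ∑ᵢ (-1)ⁱ⁺ʲ (δⱼ × 1)♯ (δᵢ × 1)♯ c = 0`: the square of the alternating coface differential
vanishes (the cosimplicial identities `δᵢ δⱼ = δⱼ₊₁ δᵢ`, `i ≤ j`). [folklore] -/
lemma prismRim_prismRim (n k : ℕ) (c : CChain R (Cyl.{u} n) k) : prismRim R (n + 1) k (prismRim R n k c) = 0 := by
  have h := AlternatingCofaceMapComplex.d_squared (cylChains.{u} R k) n
  have h' := congrArg (fun φ => φ.hom c) h
  simp only [ModuleCat.hom_comp, LinearMap.comp_apply] at h'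
  rw [cylChains_objD_hom_apply, cylChains_objD_hom_apply] at h'
  exact h'

/-- The rim operator commutes with the boundary. [folklore] -/
lemma bd_prismRim (n k : ℕ) (c : CChain R (Cyl.{u} n) (k + 1)) :
    csingularChainComplex.bd R k (prismRim R n (k + 1) c) = prismRim R n k (csingularChainComplex.bd R k c) := by
  simp only [prismRim, map_sum, map_smul, bd_chainPush]

/-- The rim operator commutes with push-forward of elementary chains in the form needed for the
top and bottom simplices: `∑ⱼ (-1)ʲ (δⱼ × 1)♯ (single τ r)`. [folklore] -/
lemma prismRim_single (n k : ℕ) (τ : SingularSimplex (Cyl.{u} n) k) (r : R) :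
    prismRim R n k (Finsupp.single τ r) =
      ∑ j : Fin (n + 2), ((-1 : R) ^ (j : ℕ)) • Finsupp.single (τ.map (cylFace n j)) r := by
  simp only [prismRim, chainPush_single]

/-- `∂ ι₁ = ∑ⱼ (-1)ʲ (δⱼ × 1)♯ ι₁`: the boundary of the top simplex of `Δⁿ⁺¹ × I` is the rim of
the top simplex of `Δⁿ × I`. [folklore] -/
lemma bd_single_topSimplex (n : ℕ) (r : R) :
    csingularChainComplex.bd R n (Finsupp.single (topSimplex.{u} (n + 1)) r) =
      prismRim R n n (Finsupp.single (topSimplex n) r) := by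
  rw [csingularChainComplex.bd_single, prismRim_single]
  simp only [topSimplex_face]

/-- `∂ ι₀ = ∑ⱼ (-1)ʲ (δⱼ × 1)♯ ι₀` (bottom simplices). [folklore] -/
lemma bd_single_botSimplex (n : ℕ) (r : R) :
    csingularChainComplex.bd R n (Finsupp.single (botSimplex.{u} (n + 1)) r) =
      prismRim R n n (Finsupp.single (botSimplex n) r) := by
  rw [csingularChainComplex.bd_single, prismRim_single]
  simp only [botSimplex_face]

/-! ### Acyclicity of contractible spaces in the concrete model -/

/-- In a contractible space every concrete `(k+1)`-cycle is a boundary, for any coefficient module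
(Hatcher 2002, Prop. 2.8 with Cor. 2.11; element form of
`isZero_csingularHomology_of_contractibleSpace`). Used here for the cylinders `Δⁿ × I`. [folklore] -/
lemma exists_bd_eq_of_bd_eq_zero_of_contractibleSpace {W : Type u} [TopologicalSpace W]
    [ContractibleSpace W] {M : Type v} [AddCommGroup M] [Module R M] (k : ℕ) (z : CChain M W (k + 1))
    (hz : csingularChainComplex.bd R k z = 0) :
    ∃ w : CChain M W (k + 2), csingularChainComplex.bd R (k + 1) w = z := by
  have hiso := isZero_csingularHomology_of_contractibleSpace R M (X := W) (n := k + 1) (by omega)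
  rw [isZero_homology_iff] at hiso
  have aux : ∀ {i j : ℕ}, (ComplexShape.down ℕ).prev (k + 1) = i → (ComplexShape.down ℕ).next (k + 1) = j →
      ∀ z : (csingularChainComplex R M W).X (k + 1),
        (csingularChainComplex R M W).d (k + 1) j z = 0 →
          ∃ w : (csingularChainComplex R M W).X i, (csingularChainComplex R M W).d i (k + 1) w = z := by
    intro i j hi hj z hz
    subst hi hj
    exact hiso z hz
  obtain ⟨w, hw⟩ := aux (ChainComplex.prev ℕ (k + 1)) (ChainComplex.next_nat_succ k) z
    (by rw [csingularChainComplex.d_apply]; exact hz)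
  exact ⟨w, by rw [← csingularChainComplex.d_apply]; exact hw⟩

/-! ### The universal prism chains -/

section Prism

variable (R)

/-- The path simplex of the cylinder `Δ⁰ × I` over the point: the singular `1`-simplex
`z ↦ (pt, z₁)` running from the bottom (`z₁ = 0`) to the top (`z₁ = 1`); its boundary is
`ι₁ - ι₀` (`bd_single_pathSimplex`). This is the prism chain in dimension `0`. [folklore] -/
def pathSimplex : SingularSimplex (Cyl.{u} 0) 1 :=
  ofMap ⟨fun z => ⟨(default, ⟨z 1, ⟨stdSimplex.zero_le z 1, stdSimplex.le_one z 1⟩⟩)⟩,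
    continuous_uliftUp.comp (continuous_const.prodMk (Continuous.subtype_mk
      ((continuous_apply 1).comp continuous_subtype_val) _))⟩

/-- `∂ (path simplex) = ι₁ - ι₀` in `C₀(Δ⁰ × I)`. [folklore] -/
lemma bd_single_pathSimplex (r : R) :
    csingularChainComplex.bd R 0 (Finsupp.single (pathSimplex.{u}) r) =
      Finsupp.single (topSimplex 0) r - Finsupp.single (botSimplex 0) r := by
  have h0 : (pathSimplex.{u}).face 0 = topSimplex 0 := by
    rw [pathSimplex, topSimplex, ofMap_face]
    congr 1
    ext w : 1
    change ULift.up (default, _) = ULift.up (w, (1 : unitInterval))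
    congr 1
    refine Prod.ext (Subsingleton.elim _ _) (Subtype.ext ?_)
    change (stdFace 0 w : Fin 2 → ℝ) 1 = 1
    have h := stdFace_apply_succAbove (0 : Fin 2) w 0
    rw [Fin.succAbove_zero, Fin.succ_zero_eq_one] at h
    rw [h]
    have hw := w.2.2
    rw [Fin.sum_univ_one] at hw
    exact hw
  have h1 : (pathSimplex.{u}).face 1 = botSimplex 0 := by
    rw [pathSimplex, botSimplex, ofMap_face]
    congr 1
    ext w : 1
    change ULift.up (default, _) = ULift.up (w, (0 : unitInterval))
    congr 1
    refine Prod.ext (Subsingleton.elim _ _) (Subtype.ext ?_)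
    exact stdFace_apply_self (1 : Fin 2) w
  rw [csingularChainComplex.bd_single, Fin.sum_univ_two, h0, h1]
  simp only [Fin.val_zero, pow_zero, one_smul, Fin.val_one, pow_one, neg_smul, ← sub_eq_add_neg]

/-- Two consecutive universal prism chains together with the prism boundary formula for the upper
one: the state of the inductive construction (Eilenberg 1944; Hatcher 2002, proof of Thm. 2.10,
`∂P = g♯ - f♯ - P∂`). [folklore] -/
structure PrismData (n : ℕ) where
  /-- the prism chain on `Δⁿ × I` -/
  lo : CChain R (Cyl.{u} n) (n + 1)
  /-- the prism chain on `Δⁿ⁺¹ × I` -/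
  hi : CChain R (Cyl.{u} (n + 1)) (n + 2)
  /-- the prism boundary formula `∂ hi = ι₁ - ι₀ - ∑ⱼ (-1)ʲ (δⱼ × 1)♯ lo` -/
  bd_hi : csingularChainComplex.bd R (n + 1) hi =
    Finsupp.single (topSimplex (n + 1)) 1 - Finsupp.single (botSimplex (n + 1)) 1 - prismRim R n (n + 1) lo

variable {R}

/-- The right-hand side `ι₁ - ι₀ - ∑ⱼ (-1)ʲ (δⱼ × 1)♯ c` of the prism boundary formula one
dimension up is a cycle as soon as `c` satisfies the prism boundary formula (the terms
`∑ⱼ ∑ᵢ ± (δⱼ × 1)♯ (δᵢ × 1)♯` cancel, `prismRim_prismRim`). [folklore] -/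
lemma bd_rhs_eq_zero (n : ℕ) (c : CChain R (Cyl.{u} (n + 1)) (n + 2))
    (lo : CChain R (Cyl.{u} n) (n + 1))
    (hc : csingularChainComplex.bd R (n + 1) c =
      Finsupp.single (topSimplex (n + 1)) 1 - Finsupp.single (botSimplex (n + 1)) 1 -
        prismRim R n (n + 1) lo) :
    csingularChainComplex.bd R (n + 1)
      (Finsupp.single (topSimplex.{u} (n + 2)) (1 : R) - Finsupp.single (botSimplex (n + 2)) 1 -
        prismRim R (n + 1) (n + 2) c) = 0 := by
  rw [map_sub, map_sub, bd_single_topSimplex, bd_single_botSimplex, bd_prismRim, hc, prismRim, prismRim, prismRim]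
  simp only [map_sub, smul_sub, Finset.sum_sub_distrib]
  rw [← prismRim, ← prismRim, ← prismRim, prismRim_prismRim, sub_zero, sub_self]

/-- The inductive step: keep the upper prism chain and choose a new one above it, a filling of the
cycle `ι₁ - ι₀ - ∑ⱼ (-1)ʲ (δⱼ × 1)♯ hi` in the acyclic cylinder `Δⁿ⁺² × I`. [folklore] -/
def PrismData.next {n : ℕ} (P : PrismData.{u} R n) : PrismData.{u} R (n + 1) where
  lo := P.hi
  hi := Classical.choose (exists_bd_eq_of_bd_eq_zero_of_contractibleSpace (W := Cyl.{u} (n + 2)) (n + 1) _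
    (bd_rhs_eq_zero n P.hi P.lo P.bd_hi))
  bd_hi := Classical.choose_spec (exists_bd_eq_of_bd_eq_zero_of_contractibleSpace (W := Cyl.{u} (n + 2)) (n + 1) _
    (bd_rhs_eq_zero n P.hi P.lo P.bd_hi))

/-- The cycle `ι₁ - ι₀ - ∑ⱼ (-1)ʲ (δⱼ × 1)♯ (path simplex)` of `Δ¹ × I` filled at the start of the
induction. [folklore] -/
lemma bd_rhs_zero_eq_zero :
    csingularChainComplex.bd R 0
      (Finsupp.single (topSimplex.{u} 1) (1 : R) - Finsupp.single (botSimplex 1) 1 -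
        prismRim R 0 1 (Finsupp.single pathSimplex 1)) = 0 := by
  rw [map_sub, map_sub, bd_single_topSimplex, bd_single_botSimplex, bd_prismRim, bd_single_pathSimplex,
    prismRim, prismRim, prismRim]
  simp only [map_sub, smul_sub, Finset.sum_sub_distrib, sub_self]

variable (R) in
/-- The start of the induction: the path simplex on `Δ⁰ × I` and a filling above it. [folklore] -/
def PrismData.zero : PrismData.{u} R 0 where
  lo := Finsupp.single pathSimplex 1
  hi := Classical.choose (exists_bd_eq_of_bd_eq_zero_of_contractibleSpace (W := Cyl.{u} 1) 0 _ bd_rhs_zero_eq_zero)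
  bd_hi := Classical.choose_spec (exists_bd_eq_of_bd_eq_zero_of_contractibleSpace (W := Cyl.{u} 1) 0 _ bd_rhs_zero_eq_zero)

variable (R)

/-- The sequence of states of the inductive construction of the universal prism chains. [folklore] -/
def prismSeq : (n : ℕ) → PrismData.{u} R n
  | 0 => PrismData.zero R
  | n + 1 => (prismSeq n).next

/-- **The universal prism chain** `prismChain R n ∈ Cₙ₊₁(Δⁿ × I; R)`: a chain whose boundary is
`ι₁ - ι₀ - ∑ⱼ (-1)ʲ (δⱼ × 1)♯ (prismChain R (n-1))` (Hatcher 2002, proof of Thm. 2.10, in the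
universal form of Eilenberg 1944: built by acyclicity of the cylinder rather than by explicit
prism simplices). Pushed forward along a homotopy `F : Δⁿ × I → X` of a singular simplex it is the
prism chain of `F`. [folklore] -/
def prismChain (n : ℕ) : CChain R (Cyl.{u} n) (n + 1) := (prismSeq R n).lo

variable {R}

/-- `prismChain R 0` is the path simplex. [folklore] -/
lemma prismChain_zero : prismChain.{u} R 0 = Finsupp.single pathSimplex 1 := rfl

/-- `prismChain R (n+1)` is the upper chain of the `n`-th state. [folklore] -/
lemma prismChain_succ (n : ℕ) : prismChain.{u} R (n + 1) = (prismSeq R n).hi := by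
  cases n <;> rfl

/-- **Prism boundary formula, dimension `0`**: `∂ (prismChain 0) = ι₁ - ι₀`. [folklore] -/
theorem bd_prismChain_zero :
    csingularChainComplex.bd R 0 (prismChain.{u} R 0) =
      Finsupp.single (topSimplex 0) 1 - Finsupp.single (botSimplex 0) 1 := by
  rw [prismChain_zero, bd_single_pathSimplex]

/-- **Prism boundary formula** (Hatcher 2002, proof of Thm. 2.10, `∂P = g♯ - f♯ - P∂`, universal
form): `∂ (prismChain (n+1)) = ι₁ - ι₀ - ∑ⱼ (-1)ʲ (δⱼ × 1)♯ (prismChain n)`. [folklore] -/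
theorem bd_prismChain_succ (n : ℕ) :
    csingularChainComplex.bd R (n + 1) (prismChain.{u} R (n + 1)) =
      Finsupp.single (topSimplex (n + 1)) 1 - Finsupp.single (botSimplex (n + 1)) 1 -
        prismRim R n (n + 1) (prismChain R n) := by
  rw [prismChain_succ]
  exact (prismSeq R n).bd_hi

/-- The prism boundary formula with the rim written out as a sum of push-forwards. [folklore] -/
theorem bd_prismChain_succ' (n : ℕ) :
    csingularChainComplex.bd R (n + 1) (prismChain.{u} R (n + 1)) =
      Finsupp.single (topSimplex (n + 1)) 1 - Finsupp.single (botSimplex (n + 1)) 1 -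
        ∑ j : Fin (n + 2), ((-1 : R) ^ (j : ℕ)) • chainPush R (cylFace n j) (n + 1) (prismChain R n) :=
  bd_prismChain_succ n

end Prism

end Literature.AlgebraicTopology.SingularHomology
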